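import Literature.AnabelianGeometry.AbsoluteAnabelian.AbsTopIII.Thm19KummerContainer
import Literature.AnabelianGeometry.AbsoluteAnabelian.AbsTopIII.Thm19CuspidalDegree
import Literature.AnabelianGeometry.AbsoluteAnabelian.AbsTopIII.LinearSystems
import HarnessLib

/-!
# [AbsTopIII] Thm. 1.9, step (e): the Prop.-1.3 triple extracted from the Kummer container
# (sub-DAG statements)

Mochizuki, *Topics in Absolute Anabelian Geometry III*, §1, Theorem 1.9 (e), manuscript p. 38 (lit
key `paper:url-5493eb38cbb7`): "One constructs the additive structure on `k̄_NF^× ∪ {0}`;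
`K_{Z_NF}^× ∪ {0}` [notation as in (d)] by applying the functorial algorithm of Proposition 1.3 to the
data of the form described in Proposition 1.3, (a), (b), (c), arising from the construction of (d)
[cf. also the decomposition groups of (a), the isomorphisms of (b)]."  Prop. 1.3 p. 30: "(a) the
[abstract!] group `K_X^×`; (b) the set of [surjective] homomorphisms `V_X := {ord_x : K_X^× ↠ ℤ}`
[...] (c) for each `v = ord_x ∈ V_X`, the subgroup `U_v ⊆ K_X^×` given by the `f ∈ K_X^×` such that
`f(x) = 1`."

Sub-DAG `plan/L4/SUBDAG-AbsTopIII-Thm19.md`, row Thm19.e.r11 (cell abc-iut, D-0068 (1)); sibling of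
`Thm19Steps.lean` (a), `Thm19CuspidalDegree.lean` (b)(c), `Thm19KummerContainer.lean` (d); Prop. 1.3
itself is abc-iut-L4-t1's `AbsTopIII.Prop_1_3` over the abstract triples `ValuationEvaluationData`
(`LinearSystems.lean`, PROVED by abc-iut-L4-t7).  THIS FILE extracts the triple from the container of
(d), relative to a model `M : IntrinsicKummerModel` and a directed system `S` (typing policy θ):

* (a) `G :=` the subgroup of `lim_{→V} H¹(Π_V, M_Z)` generated by "`K_{Z_NF}^×`" (`functionFieldPart`);
* the index set `I :=` the NF-points of the levels "rational over `k′`", modulo the relation "named by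
  a common point or cusp at a deeper level" (`NFPointIndex`, `SamePoint`, `PointIndex` — "the
  decomposition groups of (a)");
* (b) `ord_x :=` the integral cuspidal degree at `x` read at any level where `x` has become a cusp,
  through THE synchronization of (b) (`HasOrderAt`, `orderAt` — "the isomorphisms of (b)";
  `CurveModel.HasCuspidalDegree`);
* (c) `U_x := {ξ | ξ|_{D} = 0}` for a decomposition group `D` (of the point, or of the cusp, over `x`)
  at any level (`HasValueOneAt`: "`f(x) = 1`" ⟺ the Kummer class of the value vanishes, `k`
  Kummer-faithful);
* the triple `evaluationTriple S : ValuationEvaluationData` and the NAMED statement `Thm19e`: it is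
  isomorphic (`ValuationEvaluationData.IsIso`) to the triple `valuationEvaluationData k K` of a function
  field `K/k` of one variable with `k` algebraically closed, `K ≅ K_{Z_NF}` (`M.NFFunctionField Z`) and
  `k ≅ k̄_NF` (`M.kbarNF Z`) — so that `Prop_1_3` (transport of the additive structure) applies.

No new Prop FACT; the new `def … : Prop` are printed intermediate statements of Thm. 1.9 (e) relative to
`M`.  HONEST FRAMING: statements-first; typed ≠ proved; nothing here bears on [IUTchIII] Cor. 3.12.
-/

noncomputable section

open CategoryTheory
open scoped Classical Pointwise

namespace Literature.AnabelianGeometry.AbsoluteAnabelian.AbsTopIII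

open Literature.NumberTheory.DiophantineGeometry
open Literature.NumberTheory.DiophantineGeometry.AlgFunctionField

universe u

namespace IntrinsicKummerModel

variable (M : IntrinsicKummerModel.{u}) {Z : M.Curve} {ι : Type u} [Preorder ι]
  (S : CurveModel.NFComplementSystem M.toCurveModel Z ι)

/-! ### The index set: NF-points of the system ("the decomposition groups of (a)") -/

/-- Raw indices: a level `i` and an NF-point of `V_i` rational over its base field `k′_i` (every
NF-point of `Z_NF` is of this form at some level, the `k′` exhausting `k̄`).
[cite: MochizukiAbsTopIII2015, Thm 1.9 (e) p.38] -/
def NFPointIndex : Type u :=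
  Σ i : ι, {x : M.Point (S.V i) // M.IsNFPoint (S.V i) x ∧ M.IsRationalPt (S.V i) x}

/-- A subgroup `D ≤ Π_{V_k}` *lies over* the point `x` of `V_i` (`i ≤ k`): its image under the
transition `Π_{V_k} → Π_{V_i}` is contained in a conjugate of the decomposition group `D_x` (the
group-theoretic shadow of "the point/cusp of `V_k` maps to `x`"). [cite: MochizukiAbsTopIII2015, Thm 1.9 (a) p.37] -/
def LiesOver {i k : ι} (hik : i ≤ k) (D : Subgroup (M.ext (S.V k)).arith) (x : M.Point (S.V i)) : Prop :=
  ∃ g : (M.ext (S.V i)).arith,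
    D.map (S.trans hik).arith.toMonoidHom ≤ MulAut.conj g • M.decomp (S.V i) x

/-- The subgroups of `Π_{V_k}` naming geometric points at level `k`: decomposition groups of NF-points
of `V_k` and cuspidal decomposition groups of `V_k` (removed NF-points).
[cite: MochizukiAbsTopIII2015, Thm 1.9 (a) p.37] -/
def levelSubgroups (k : ι) : Set (Subgroup (M.ext (S.V k)).arith) :=
  {D | (∃ w : M.Point (S.V k), M.IsNFPoint (S.V k) w ∧ D = M.decomp (S.V k) w) ∨
    ∃ c : (M.cusps (S.V k)).Cusp, D = (M.cusps (S.V k)).Dcusp c}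

/-- Two raw indices name THE SAME point of `Z_NF` when, at some common deeper level, one point or cusp
lies over both. [cite: MochizukiAbsTopIII2015, Thm 1.9 (e) p.38] -/
def SamePoint (a b : M.NFPointIndex S) : Prop :=
  ∃ (k : ι) (ha : a.1 ≤ k) (hb : b.1 ≤ k) (D : Subgroup (M.ext (S.V k)).arith),
    D ∈ M.levelSubgroups S k ∧ M.LiesOver S ha D a.2.1 ∧ M.LiesOver S hb D b.2.1

/-- **The index set (b) of the triple**: "`V_X ≃ X(k)`" for `X = Z_NF` over `k = k̄_NF` — the NF-points
of the system modulo `SamePoint`. [cite: MochizukiAbsTopIII2015, Thm 1.9 (e) p.38] -/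
def PointIndex : Type u := Quot (M.SamePoint S)

/-! ### (b) the valuations `ord_x` and (c) the subgroups `U_x`, read from the container -/

/-- `ξ ∈ lim_{→V} H¹(Π_V, M_Z)` has ORDER `n` at the raw index `(i, x)`: at some level `j ≥ i` where a
cusp `c` lies over `x`, `ξ` is represented by a class `η ∈ H¹(Π_{V_j}, M_{Z ×_{k_Z} k′_j})` of integral
cuspidal degree `n` at `c`, read through THE synchronizations of (b) (`CurveModel.HasCuspidalDegree`
for a system of cyclotome presentations of `V_j ⊆ Z ×_{k_Z} k′_j`).
[cite: MochizukiAbsTopIII2015, Thm 1.9 (e) p.38] -/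
def HasOrderAt (ξ : S.kummerContainer) (a : M.NFPointIndex S) (n : ℤ) : Prop :=
  ∃ (j : ι) (hij : a.1 ≤ j) (c : (M.cusps (S.V j)).Cusp)
    (P : M.toCurveModel.CuspSyncPresentation (S.isOpen j))
    (η : cyclotomeModH1 (M.res (S.isOpen j)) ZHatCoeff.{u}),
    M.LiesOver S hij ((M.cusps (S.V j)).Dcusp c) a.2.1 ∧
      S.toContainer j (M.pushToZ S j η) = ξ ∧ CurveModel.HasCuspidalDegree P η c n

/-- **(b) `ord_x : K_{Z_NF}^× → ℤ`** at the raw index `(i, x)`, as a function on the container (the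
order when defined, `0` otherwise; well-definedness is part of the comparison statement `Thm19e`).
[cite: MochizukiAbsTopIII2015, Thm 1.9 (e) p.38] -/
def orderAt (a : M.NFPointIndex S) (ξ : S.kummerContainer) : ℤ :=
  if h : ∃ n : ℤ, M.HasOrderAt S ξ a n then h.choose else 0

/-- `ξ` has VALUE `1` at the raw index `(i, x)` ("the `f ∈ K_X^×` such that `f(x) = 1`", Prop. 1.3
(c)): at some level `j ≥ i`, `ξ` is represented by a class whose restriction to a decomposition group
lying over `x` (of the point, or of the cusp, of `V_j` over `x`) vanishes — for a Kummer-faithful base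
field the Kummer class of the value `f(x)` vanishes iff `f(x) = 1`. [cite: MochizukiAbsTopIII2015, Thm 1.9 (e) p.38] -/
def HasValueOneAt (ξ : S.kummerContainer) (a : M.NFPointIndex S) : Prop :=
  ∃ (j : ι) (hij : a.1 ≤ j) (D : Subgroup (M.ext (S.V j)).arith)
    (η : cyclotomeModH1 (M.res (S.isOpen j)) ZHatCoeff.{u}),
    D ∈ M.levelSubgroups S j ∧ M.LiesOver S hij D a.2.1 ∧
      S.toContainer j (M.pushToZ S j η) = ξ ∧ M.classRes (S.isOpen j) D η = 0

/-! ### The triple and the comparison statement -/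

/-- **(a) "the [abstract!] group `K_X^×`"** for `X = Z_NF`: the subgroup of the container generated by
`functionFieldPart` ("`K_{Z_NF}^×`" of (d)), written multiplicatively.
[cite: MochizukiAbsTopIII2015, Thm 1.9 (e) p.38] -/
abbrev unitGroup : Type u :=
  Multiplicative (AddSubgroup.closure (M.functionFieldPart S))

/-- **The Prop.-1.3 triple `(K_{Z_NF}^×, {ord_x}, {U_x})` extracted from the construction of (d)**
("the data of the form described in Proposition 1.3, (a), (b), (c), arising from the construction of (d)
[cf. also the decomposition groups of (a), the isomorphisms of (b)]", p. 38): `G :=` the subgroup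
generated by "`K_{Z_NF}^×`", `I :=` the NF-points of the system modulo `SamePoint` (a representative is
chosen to read `ord` and `U`), `ord_x := orderAt`, `U_x :=` the subgroup generated by the elements of
value `1` at `x`. [cite: MochizukiAbsTopIII2015, Thm 1.9 (e) p.38] -/
def evaluationTriple : ValuationEvaluationData.{u} where
  G := M.unitGroup S
  I := M.PointIndex S
  ord q ξ := M.orderAt S (Quot.out q) ((Multiplicative.toAdd ξ : AddSubgroup.closure _) : S.kummerContainer)
  U q := Subgroup.closure
    {ξ | M.HasValueOneAt S ((Multiplicative.toAdd ξ : AddSubgroup.closure _) : S.kummerContainer)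
      (Quot.out q)}

/-- **Thm. 1.9 (e), relative to `M`** ("One constructs the additive structure on `k̄_NF^× ∪ {0}`;
`K_{Z_NF}^× ∪ {0}` [...] by applying the functorial algorithm of Proposition 1.3 to the data [...]
arising from the construction of (d)", p. 38): for every directed system of NF-complements `S` over a
(d)-input `Z` of the model, the extracted triple IS a triple "arising from a proper hyperbolic curve over
an algebraically closed field" to which Prop. 1.3 applies — it is isomorphic
(`ValuationEvaluationData.IsIso`) to the triple `valuationEvaluationData k K` of an algebraic function
field `K/k` of one variable of genus `≥ 2` with `k` algebraically closed, where `K ≅ K_{Z_NF}`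
(`M.NFFunctionField Z`) and `k ≅ k̄_NF` (`M.kbarNF Z`).  NAMED statement relative to `M` (then
`AbsTopIII.Prop_1_3` transports the additive structure, functorially in the triple).
CAVEAT (abc-iut self-audit finding F-w5d213-self-1, 2026-08-26; statement unchanged): "for every directed
system" OVER-QUANTIFIES — the interface's cofinality clauses only force the levels to become fine, so a
system all of whose levels remove one fixed NF-point is admitted, and for it `PointIndex S` misses that
point's places: the intended comparison with ALL places of `K_{Z_NF}/k̄_NF` fails.  Print's "`V` ranges
over" is the FULL system; the statement of record for Thm. 1.9 (e) is `Thm19eSat`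
(`Thm19EvaluationSaturated.lean`: `Thm19e` restricted to SATURATED systems, `IsSaturated`), which this
statement implies (`thm19eSat_of_thm19e`).
[cite: MochizukiAbsTopIII2015, Thm 1.9 (e) p.38] -/
def Thm19e (M : IntrinsicKummerModel.{u}) : Prop :=
  ∀ (Z : M.Curve), M.IsThm19dInput Z → ∀ (ι : Type u) [Preorder ι] [Nonempty ι] [IsDirectedOrder ι]
    (S : CurveModel.NFComplementSystem M.toCurveModel Z ι),
    ∃ (k : Type u) (K : Type u) (_ : Field k) (_ : Field K) (_ : Algebra k K),
      IsAlgClosed k ∧ IsAlgFunctionField k K ∧ 2 ≤ genus k K ∧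
        Nonempty (K ≃+* M.NFFunctionField Z) ∧ Nonempty (k ≃+* M.kbarNF Z) ∧
          ∃ (φ : (M.evaluationTriple S).G ≃* (valuationEvaluationData k K).G)
            (σ : (M.evaluationTriple S).I ≃ (valuationEvaluationData k K).I),
            (M.evaluationTriple S).IsIso (valuationEvaluationData k K) φ σ

end IntrinsicKummerModel

end Literature.AnabelianGeometry.AbsoluteAnabelian.AbsTopIII
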